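/-
Copyright (c) 2026 the pub-hodgecm-mathlib formalisation cell (harness21).  Prover seat hodgecm-mathlib-K2E3-p29 (g0), HCML Track B «K2-LIT» (build stream 29),
h413 = `stmt-HodgeConjecture-24833`, line `K2_E3_EllipticInputs`, unit U12 «Characters», PART «SC» leaf (SC-an)₂ `sig_K2E3SupercuspidalTruncatedCharAnalyticTwo` (road «FC₂»,
CLOSE-OUT DAY strike line L4 `stub_StCharTS`, LINE-LEAD K2E3-plan (g4) deal D135, architect K2E3-p25 (g3)): the `Fin 2` twin of ★ (M5h) FILE A «WEIGHT KIT»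
`K2E3SupercuspidalTruncatedCharWeightKit` — the model-side pieces of the domination weight `W ≍ T⁻¹(1 + |log T|)` on a unitary group IN TWO VARIABLES: the shell index, the
continuity of the token and `T⁻¹(1+|log T|)^k ∈ L¹_loc` FROM the rank-one (ε6)₂ letter `T^{−5∕4} ∈ L¹_loc` (hypothesis-first); the shell index and the height-weighted
multiples are the template's GENERIC §2∕§5, cited by their ★ names.  2026-09-04.
-/
import Summits.HodgeConjecture.HodgeConjecture.Theorems.K2E3SupercuspidalTruncatedCharWeightKit   -- ★ (M5h) FILE A (K2E5-p04): the `Fin 3` template with the GENERIC §2∕§5 (cited, not restated); brings ★ p856410 `locallyIntegrable_inv_mul_log_pow`, ★ (ε7) dictionary `inv_coe_sqrt_sqrt_rpow_eq`∕`enorm_coe_rpow_neg_le`, ★ `locallyIntegrable_of_forall_exists_setLIntegral_lt_top`, the place frame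
import Summits.HodgeConjecture.HodgeConjecture.Theorems.K2E3HC14EllU11Haar                        -- ★ (K2E5-p15): `locallyCompactSpace_unitary`, `secondCountableTopology_unitary` for `U(σ, J)(K)`, `J : Matrix (Fin 2) (Fin 2) K`
import Summits.HodgeConjecture.HodgeConjecture.Theorems.K2E3U11WeylDiscrGroupToLie                 -- ★ (HCD₂ FILE 2b, K2E3-p27): `continuous_discr_charpoly_fin_two`
import Literature.NumberTheory.Automorphic.AdicCompletionLocalField                                 -- ★ `instIsNonarchimedeanLocalFieldAdicCompletion` (the place `L_w` is a local field)
import HarnessLib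

/-!
# h413 ∕ Track B «K2-LIT», line `K2_E3_EllipticInputs`, unit U12, PART «SC», leaf (SC-an)₂ — (M5h)₂ FILE A «WEIGHT KIT» ON A UNITARY GROUP IN TWO VARIABLES
# `U(σ, J)(K)`, `J : Matrix (Fin 2) (Fin 2) K`, and on the place model `U(σ_w, Φ₂)(L_w)` (Harish-Chandra 1970, Part VII §1 Theorem 15, §3 pp. 71–73, at rank one)

Cell `pub/hodgecm-mathlib`, crux H413 = `stmt-HodgeConjecture-24833`, route of record `HCCMUnconditional`; chair K2-lead (g2), LINE-LEAD ∕ dealer K2E3-plan (g4) (deal D135,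
L4 EMIT #1 2026-09-04T14:52:25Z), architect K2E3-p25 (g3), (M5h₂) chain desk K2E3-p27 (g0), FC₂ binder desk K2E3-p23 (g7).
THEOREMS ONLY (no `def`, no `instance`, no `notation`, no named-fact `def … : Prop` hypothesis, no `sorry`); lane `--supports stmt-HodgeConjecture-24833 --as helper`, count-neutral.

WHAT.  The template ★ `K2E3SupercuspidalTruncatedCharWeightKit` (the `Fin 3` weight kit of the (M5h) packaging `W := W_M ∘ e`, `W_M(m) = K·(h(m)+1)·q^{h(m)}·T(m)⁻¹(1 + |log T(m)|)`,
`h = Ω_M.find`, `T = √√(|disc χ|·|det|⁻²)`) has five sections; this file is its twin for `2 × 2` unitary groups, written for the `Fin 3 ↦ Fin 2` port of the (M5h) chain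
(road «FC₂» of PART «SC»: ★ `K2E3FinConjAssemblyTwo`, ★ `K2E3FinConjCartanCoverTwo`, K2E3-p23's `…AnalyticTwoOfLetters.sigSCanTwo_of_letters … (hM5h₂)`).
* §2 `exists_shellIndex`, §5 `measurable_find` ∕ `locallyIntegrable_heightWeight` of the template are GENERIC (any non-archimedean local field ∕ any T₂ space): they are
  NOT restated (gate rule `dedup.landed`) — the `2 × 2` chain cites the ★ names `K2E3SupercuspidalTruncatedCharWeightKit.exists_shellIndex` ∕ `.measurable_find` ∕
  `.locallyIntegrable_heightWeight` directly (porters: keep the `WeightKit.` prefix for these three, rename only the `Fin`-typed heads to `WeightKitTwo.`).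
* §3 **`continuous_weylRatio_comp`, `continuous_token`** — `g ↦ |disc χ_{ρ g}|·|det ρ g|⁻²` and `m ↦ T(m)` are continuous for `ρ : G →* GL₂(K)` continuous ∕ on `U(σ, J)(K)`
  (★ `continuous_discr_charpoly_fin_two`, `det` continuous and non-zero on `GL₂`).  The token keeps the template's shape `|det|⁻²` (the `Fin 3 ↦ Fin 2` image; on `U` one has
  `|det| = 1`, so it agrees numerically with the `|det|⁻¹` of ★ `K2E3U11WeylDiscrModel.hcd₂_model`).
* §4 **`locallyIntegrable_inv_token_rpow_five_quarters_of_hcd`, `locallyIntegrable_inv_token_mul_log_pow_of_hcd`** (generic `K`, `σ` continuous, any `J`) and their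
  place-model instances **`…_place`** on `U(σ_w, J)(L_w)`: `(T^{1+1∕4})⁻¹ ∈ L¹_loc` and `T⁻¹(1 + |log T|)^k ∈ L¹_loc` for every Haar `ν` and every `k`, FROM the rank-one
  (ε6)₂ letter `hHCD : ∀ g₀, ∃ U ∈ 𝓝 g₀, ∫⁻_U (|disc χ_g|·|det g|⁻²)^{−(1+1∕4)∕4} ∂ν < ∞` taken HYPOTHESIS-FIRST (it is the `Fin 2` image of the conclusion of ★ (ε6)
  `K2E3HCDModelRpow.hcd_model_rpow` at `r = 5∕16`; its rank-one proof — the «(ε)₂ re-thread» of ★ K2E3-p27's HCD₂ FILES 1∕2a∕2b∕3 at Lie exponent `s = 2r = 5∕8 < 1`, whose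
  Lie-level input ★ `F0P3cStCharTSQuadraticFormNegHalf.forall_exists_nhds_setLIntegral_ternaryQuadraticForm_rpow_neg_lt_top` already holds for every `s < 1` — is NOT in
  this file).  Proof of §4 = the template's, token for token: ★ (ε7) dictionary `inv_coe_sqrt_sqrt_rpow_eq` ∕ `enorm_coe_rpow_neg_le`, ★ `locallyIntegrable_of_forall_exists_…`,
  ★ p856410 `locallyIntegrable_inv_mul_log_pow` at `δ = 1∕4` with §3.
* §1 of the template (`exists_const_integral_heightBall_norm_conj_le_shell_place`, the split shell bound with its binders paid at the place) is NOT ported here: it is the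
  binder discharge of ★ `K2E3SupercuspBallBoundSplitAssembly.exists_const_integral_heightBall_norm_conj_le_shell` (`Fin 3`-typed, constants `42m`, `16τ` of the `3 × 3`
  ball algebra) through ★ [M2a] `K2E3SupercuspModelFrameAtPlace` ∕ ★ `K2E3SplitTorusQuotientMeasure…_place` ∕ ★ `K2E3SplitTorusOrbitalBoundPlace`, none of whose `Fin 2`
  twins exists yet (FrameAtPlaceTwo = deal D136); it is the LAST brick of the (M5e)₂ sub-chain and goes to the sequel `…WeightKitPlaceTwo` once `…BallBoundSplitAssemblyTwo`
  fixes the rank-one constants.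

HONEST LABEL.  HC_CM is proved only modulo the 7 printed citations (2 remaining named inputs: hLiu418 = `stmt-HodgeConjecture-24832`, h413 = `stmt-HodgeConjecture-24833`)
until rung 0 closes; count-neutral helper (measure-theoretic packaging; nothing printed is asserted as a fact); §4 is CONDITIONAL on the (ε6)₂ letter `hHCD` until the
«(ε)₂ re-thread» lands; (SC-an)₂ stays OPEN.

## References
* [HarishChandra1970] Harish-Chandra (notes by G. van Dijk), *Harmonic Analysis on Reductive p-adic Groups*, LNM 162 (1970), Part VII §1 Thm. 15 p. 63, §2 Theorems 18–20
  pp. 69–70, §3 pp. 71–73.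
* [Rogawski1990] J. D. Rogawski, *Automorphic Representations of Unitary Groups in Three Variables*, Ann. of Math. Stud. 123 (1990), §4.9 p. 54, §12.5 p. 182.
* [Folland1999] G. B. Folland, *Real Analysis* (2nd ed., 1999), §2.3, §3.3 (local integrability; products with locally bounded factors).
* [GetzHahn2024] J. R. Getz, H. Hahn, *An Introduction to Automorphic Representations*, GTM 300 (2024), §3.2 (local compactness of `G(K)`).
-/

set_option autoImplicit false
-- the mandated namespace repeats the single-problem summit's segment (`HodgeConjecture.HodgeConjecture`)
set_option linter.dupNamespace false

noncomputable section

open MeasureTheory Measure Set Filter Topology NumberField IsDedekindDomain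
open scoped NNReal ENNReal Pointwise Matrix MatrixGroups WithZero
open ValuativeRel
open Literature.NumberTheory.Automorphic Literature.NumberTheory.Automorphic.UnitaryGroup Literature.NumberTheory.Rogawski1990
open Literature.NumberTheory.GaloisRepresentations Literature.NumberTheory.GaloisRepresentations.IsNonarchimedeanLocalField

namespace Summit.HodgeConjecture.HodgeConjecture.Cruxes.H413.K2E3SupercuspidalTruncatedCharWeightKitTwo

/-! ## §3 The rank-one Weyl ratio and token are continuous -/

section Token

variable {K : Type*} [Field K] [ValuativeRel K] [TopologicalSpace K] [IsNonarchimedeanLocalField K]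
variable {G : Type*} [Group G] [TopologicalSpace G] (ρ : G →* GL (Fin 2) K)

/-- **`g ↦ |disc χ_{ρ g}|·|det ρ g|⁻²` IS CONTINUOUS ON `G`** for `ρ : G →* GL₂(K)` continuous — ★ `continuous_discr_charpoly_fin_two`, continuity of `det` and of `‖·‖_K`
(★ `LocalFieldHaar.continuous_normAbs`), and `x ↦ x⁻¹` on `ℝ≥0` at the non-zero values `|det ρ g|²` (the `2 × 2` twin of ★ `K2E3HCDGroupToLieRpow.continuous_weylRatio_comp`).
[cite: HarishChandra1970, Part VII §1 Thm. 15] [cite: Rogawski1990, §4.9 p. 54] -/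
theorem continuous_weylRatio_comp (hρc : Continuous ρ) :
    Continuous fun g : G => normAbs K ((ρ g : GL (Fin 2) K) : Matrix (Fin 2) (Fin 2) K).charpoly.discr *
        ((normAbs K ((ρ g : GL (Fin 2) K) : Matrix (Fin 2) (Fin 2) K).det) ^ 2)⁻¹ := by
  have hM : Continuous fun g : G => ((ρ g : GL (Fin 2) K) : Matrix (Fin 2) (Fin 2) K) := Units.continuous_val.comp hρc
  have h1 : Continuous fun g : G => normAbs K ((ρ g : GL (Fin 2) K) : Matrix (Fin 2) (Fin 2) K).charpoly.discr :=
    LocalFieldHaar.continuous_normAbs.comp (K2E3U11WeylDiscrGroupToLie.continuous_discr_charpoly_fin_two.comp hM)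
  have h2 : Continuous fun g : G => (normAbs K ((ρ g : GL (Fin 2) K) : Matrix (Fin 2) (Fin 2) K).det) ^ 2 :=
    (LocalFieldHaar.continuous_normAbs.comp hM.matrix_det).pow 2
  refine h1.mul (h2.inv₀ fun g => pow_ne_zero 2 ((map_ne_zero (normAbs K)).2 ?_))
  have h := (Matrix.GeneralLinearGroup.det (ρ g)).ne_zero
  rwa [Matrix.GeneralLinearGroup.val_det_apply] at h

/-- **`m ↦ T(m) = √√(|disc χ_m| · |det m|⁻²)` IS CONTINUOUS ON `U(σ, J)(K)`**, `J : Matrix (Fin 2) (Fin 2) K` (§3 `continuous_weylRatio_comp` at the inclusion `U ≤ GL₂(K)`,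
`NNReal.continuous_sqrt` twice) — the `2 × 2` twin of ★ `K2E3SupercuspidalTruncatedCharWeightKit.continuous_token`. [cite: HarishChandra1970, Part VII §1 Thm. 15] [cite: Rogawski1990, §4.9 p. 54] -/
theorem continuous_token (σ : K →+* K) (J : Matrix (Fin 2) (Fin 2) K) :
    Continuous fun m : ↥(unitaryGroupOfForm σ J) => NNReal.sqrt (NNReal.sqrt
      (normAbs K (((m : GL (Fin 2) K) : Matrix (Fin 2) (Fin 2) K)).charpoly.discr *
        (normAbs K (((m : GL (Fin 2) K) : Matrix (Fin 2) (Fin 2) K)).det ^ 2)⁻¹)) :=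
  NNReal.continuous_sqrt.comp (NNReal.continuous_sqrt.comp
    (continuous_weylRatio_comp (unitaryGroupOfForm σ J).subtype continuous_subtype_val))

end Token

/-! ## §4 `T⁻¹(1 + |log T|)^k` is locally integrable FROM the rank-one (ε6)₂ letter `T^{−5∕4} ∈ L¹_loc` (hypothesis-first) -/

section LocInt

variable {K : Type*} [Field K] [ValuativeRel K] [TopologicalSpace K] [IsNonarchimedeanLocalField K] {σ : K →+* K}

/-- **`(T^{1+δ})⁻¹ ∈ L¹_loc(U(σ, J)(K), ν)` at `δ = 1∕4` FROM THE (ε6)₂ LETTER.**  For `σ` continuous, `J : Matrix (Fin 2) (Fin 2) K`, a Haar measure `ν` on `U = U(σ, J)(K)`, and the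
rank-one letter `hHCD : ∀ g₀, ∃ U ∈ 𝓝 g₀, ∫⁻_U (↑(|disc χ_g|·|det g|⁻²))^{−(1+1∕4)∕4} ∂ν < ∞` (the `Fin 2` image of the conclusion of ★ (ε6) `K2E3HCDModelRpow.hcd_model_rpow` at
`r = 5∕16`, to be discharged by the «(ε)₂ re-thread»), the real function `m ↦ ((T m)^{1+1∕4})⁻¹` is locally integrable: ★ `locallyIntegrable_of_forall_exists_setLIntegral_lt_top` with
the pointwise comparison ★ `enorm_coe_rpow_neg_le` and the identity ★ `inv_coe_sqrt_sqrt_rpow_eq` (`((√√x)^{1+δ})⁻¹ = x^{−(1+δ)∕4}`); measurability from §3.  (Template: ★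
`K2E3SupercuspidalTruncatedCharWeightKit.locallyIntegrable_inv_token_rpow_five_quarters`, whose `hcd_model_rpow` step is the hypothesis here.) [cite: HarishChandra1970, Part VII §1 Thm. 15 p. 63] -/
theorem locallyIntegrable_inv_token_rpow_five_quarters_of_hcd (J : Matrix (Fin 2) (Fin 2) K)
    [MeasurableSpace ↥(unitaryGroupOfForm σ J)] [BorelSpace ↥(unitaryGroupOfForm σ J)] (ν : Measure ↥(unitaryGroupOfForm σ J))
    (hHCD : ∀ g₀ : ↥(unitaryGroupOfForm σ J), ∃ U ∈ 𝓝 g₀, ∫⁻ g in U,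
      (((normAbs K (((g : GL (Fin 2) K) : Matrix (Fin 2) (Fin 2) K)).charpoly.discr *
        (normAbs K (((g : GL (Fin 2) K) : Matrix (Fin 2) (Fin 2) K)).det ^ 2)⁻¹ : ℝ≥0) : ℝ≥0∞)) ^ (-((1 + 1 / 4) / 4 : ℝ)) ∂ν < ∞) :
    LocallyIntegrable (fun m : ↥(unitaryGroupOfForm σ J) =>
      ((((NNReal.sqrt (NNReal.sqrt
        (normAbs K (((m : GL (Fin 2) K) : Matrix (Fin 2) (Fin 2) K)).charpoly.discr *
          (normAbs K (((m : GL (Fin 2) K) : Matrix (Fin 2) (Fin 2) K)).det ^ 2)⁻¹)) : ℝ≥0) : ℝ)) ^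
        (1 + (1 / 4 : ℝ)))⁻¹) ν := by
  have hr0 : (0 : ℝ) ≤ (1 + 1 / 4) / 4 := by norm_num
  -- the real integrand, rewritten as a real power of the `√`-free ratio
  have heq : (fun m : ↥(unitaryGroupOfForm σ J) =>
      ((((NNReal.sqrt (NNReal.sqrt
        (normAbs K (((m : GL (Fin 2) K) : Matrix (Fin 2) (Fin 2) K)).charpoly.discr *
          (normAbs K (((m : GL (Fin 2) K) : Matrix (Fin 2) (Fin 2) K)).det ^ 2)⁻¹)) : ℝ≥0) : ℝ)) ^
        (1 + (1 / 4 : ℝ)))⁻¹) =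
      fun m : ↥(unitaryGroupOfForm σ J) =>
        (((normAbs K (((m : GL (Fin 2) K) : Matrix (Fin 2) (Fin 2) K)).charpoly.discr *
          (normAbs K (((m : GL (Fin 2) K) : Matrix (Fin 2) (Fin 2) K)).det ^ 2)⁻¹ : ℝ≥0) : ℝ)) ^
        (-((1 + 1 / 4) / 4 : ℝ)) := funext fun m => K2E3WeylDiscrLocIntRpow.inv_coe_sqrt_sqrt_rpow_eq _ _
  rw [heq]
  have hcont : Continuous fun m : ↥(unitaryGroupOfForm σ J) =>
      (normAbs K (((m : GL (Fin 2) K) : Matrix (Fin 2) (Fin 2) K)).charpoly.discr *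
          (normAbs K (((m : GL (Fin 2) K) : Matrix (Fin 2) (Fin 2) K)).det ^ 2)⁻¹ : ℝ≥0) :=
    continuous_weylRatio_comp (unitaryGroupOfForm σ J).subtype continuous_subtype_val
  have hmeas : Measurable fun m : ↥(unitaryGroupOfForm σ J) =>
      (((normAbs K (((m : GL (Fin 2) K) : Matrix (Fin 2) (Fin 2) K)).charpoly.discr *
          (normAbs K (((m : GL (Fin 2) K) : Matrix (Fin 2) (Fin 2) K)).det ^ 2)⁻¹ : ℝ≥0) : ℝ)) ^
        (-((1 + 1 / 4) / 4 : ℝ)) := (NNReal.continuous_coe.comp hcont).measurable.pow_const _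
  exact F0P3cStCharTSHCDLocIntTransport.locallyIntegrable_of_forall_exists_setLIntegral_lt_top hmeas.aestronglyMeasurable _
    (fun m => K2E3WeylDiscrLocIntRpow.enorm_coe_rpow_neg_le _ hr0) hHCD

/-- **`T⁻¹ (1 + |log T|)^k ∈ L¹_loc(U(σ, J)(K), ν)` FROM THE (ε6)₂ LETTER**, for `σ` continuous, every Haar `ν` and every `k : ℕ` — ★ p856410 `locallyIntegrable_inv_mul_log_pow` (`φ := T`
continuous, §3 `continuous_token`; `δ = 1∕4`) on the previous theorem; `U(σ, J)(K)` is locally compact (★ `K2E3HC14EllU11Haar.locallyCompactSpace_unitary`), so `ν` is locally finite.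
This is the `hW` input of the (M5h)₂ packaging on the model, with room for any polynomial-in-`log` factor.  (Template: ★ `…WeightKit.locallyIntegrable_inv_token_mul_log_pow`.)
[cite: HarishChandra1970, Part VII §1 Thm. 15 p. 63; §3 p. 73] -/
theorem locallyIntegrable_inv_token_mul_log_pow_of_hcd (hσc : Continuous σ) (J : Matrix (Fin 2) (Fin 2) K)
    [MeasurableSpace ↥(unitaryGroupOfForm σ J)] [BorelSpace ↥(unitaryGroupOfForm σ J)] (ν : Measure ↥(unitaryGroupOfForm σ J)) [ν.IsHaarMeasure] (k : ℕ)
    (hHCD : ∀ g₀ : ↥(unitaryGroupOfForm σ J), ∃ U ∈ 𝓝 g₀, ∫⁻ g in U,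
      (((normAbs K (((g : GL (Fin 2) K) : Matrix (Fin 2) (Fin 2) K)).charpoly.discr *
        (normAbs K (((g : GL (Fin 2) K) : Matrix (Fin 2) (Fin 2) K)).det ^ 2)⁻¹ : ℝ≥0) : ℝ≥0∞)) ^ (-((1 + 1 / 4) / 4 : ℝ)) ∂ν < ∞) :
    LocallyIntegrable (fun m : ↥(unitaryGroupOfForm σ J) =>
      (((NNReal.sqrt (NNReal.sqrt
        (normAbs K (((m : GL (Fin 2) K) : Matrix (Fin 2) (Fin 2) K)).charpoly.discr *
          (normAbs K (((m : GL (Fin 2) K) : Matrix (Fin 2) (Fin 2) K)).det ^ 2)⁻¹)) : ℝ≥0) : ℝ))⁻¹ *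
        (1 + |Real.log (((NNReal.sqrt (NNReal.sqrt
          (normAbs K (((m : GL (Fin 2) K) : Matrix (Fin 2) (Fin 2) K)).charpoly.discr *
            (normAbs K (((m : GL (Fin 2) K) : Matrix (Fin 2) (Fin 2) K)).det ^ 2)⁻¹)) : ℝ≥0) : ℝ))|) ^ k) ν := by
  haveI : LocallyCompactSpace ↥(unitaryGroupOfForm σ J) := K2E3HC14EllU11Haar.locallyCompactSpace_unitary hσc J
  exact K2E3LogWeightLocallyIntegrable.locallyIntegrable_inv_mul_log_pow ν (continuous_token σ J) (by norm_num : (0 : ℝ) < 1 / 4) k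
    (locallyIntegrable_inv_token_rpow_five_quarters_of_hcd J ν hHCD)

end LocInt

/-! ## §4′ The same on the place model `U(σ_w, J)(L_w)` (the frame of K2E3-p23's `hM5h₂` binder, `J = (StdForm.antidiagonal 2).over L_w` or any `J`) -/

section Place

variable (L : Type) [Field L] [NumberField L] [IsCMField L] {v : HeightOneSpectrum (𝓞 ↥(maximalRealSubfield L))}
  (w : PlacesOver L v) (hw : IsCMField.complexConj L • w.1 = w.1)

/-- **`(T^{1+1∕4})⁻¹ ∈ L¹_loc(U(σ_w, J)(L_w), ν)` FROM THE (ε6)₂ LETTER AT THE PLACE** — §4 `locallyIntegrable_inv_token_rpow_five_quarters_of_hcd` at `K := L_w`, `σ := σ_w`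
(`galAdicCompletionMap`), the binder shape of the template's place head with `Fin 3 ↦ Fin 2` plus the letter `hHCD` (no `hJ` is needed before the letter is discharged).
[cite: HarishChandra1970, Part VII §1 Thm. 15 p. 63] -/
theorem locallyIntegrable_inv_token_rpow_five_quarters_place (J : Matrix (Fin 2) (Fin 2) (w.1.adicCompletion L))
    [MeasurableSpace ↥(unitaryGroupOfForm (galAdicCompletionMap (L := L) (IsCMField.complexConj L) hw) J)]
    [BorelSpace ↥(unitaryGroupOfForm (galAdicCompletionMap (L := L) (IsCMField.complexConj L) hw) J)]
    (ν : Measure ↥(unitaryGroupOfForm (galAdicCompletionMap (L := L) (IsCMField.complexConj L) hw) J))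
    (hHCD : ∀ g₀ : ↥(unitaryGroupOfForm (galAdicCompletionMap (L := L) (IsCMField.complexConj L) hw) J), ∃ U ∈ 𝓝 g₀, ∫⁻ g in U,
      (((normAbs (w.1.adicCompletion L) (((g : GL (Fin 2) (w.1.adicCompletion L)) : Matrix (Fin 2) (Fin 2) (w.1.adicCompletion L))).charpoly.discr *
        (normAbs (w.1.adicCompletion L) (((g : GL (Fin 2) (w.1.adicCompletion L)) : Matrix (Fin 2) (Fin 2) (w.1.adicCompletion L))).det ^ 2)⁻¹ : ℝ≥0) : ℝ≥0∞)) ^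
        (-((1 + 1 / 4) / 4 : ℝ)) ∂ν < ∞) :
    LocallyIntegrable (fun m : ↥(unitaryGroupOfForm (galAdicCompletionMap (L := L) (IsCMField.complexConj L) hw) J) =>
      ((((NNReal.sqrt (NNReal.sqrt
        (normAbs (w.1.adicCompletion L) (((m : GL (Fin 2) (w.1.adicCompletion L)) : Matrix (Fin 2) (Fin 2) (w.1.adicCompletion L))).charpoly.discr *
          (normAbs (w.1.adicCompletion L) (((m : GL (Fin 2) (w.1.adicCompletion L)) : Matrix (Fin 2) (Fin 2) (w.1.adicCompletion L))).det ^ 2)⁻¹)) : ℝ≥0) : ℝ)) ^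
        (1 + (1 / 4 : ℝ)))⁻¹) ν :=
  locallyIntegrable_inv_token_rpow_five_quarters_of_hcd J ν hHCD

/-- **`T⁻¹ (1 + |log T|)^k ∈ L¹_loc(U(σ_w, J)(L_w), ν)` FROM THE (ε6)₂ LETTER AT THE PLACE**, every Haar `ν`, every `k : ℕ` — §4 `locallyIntegrable_inv_token_mul_log_pow_of_hcd` at
`K := L_w`, `σ := σ_w` (continuous: ★ `continuous_galAdicCompletionMap`); the `hW` input of the (M5h)₂ packaging at the place.  (Template: ★ `…WeightKit.locallyIntegrable_inv_token_mul_log_pow`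
with `Fin 3 ↦ Fin 2`, the `hcd_model_rpow` step replaced by the letter `hHCD`.) [cite: HarishChandra1970, Part VII §1 Thm. 15 p. 63; §3 p. 73] -/
theorem locallyIntegrable_inv_token_mul_log_pow_place (J : Matrix (Fin 2) (Fin 2) (w.1.adicCompletion L))
    [MeasurableSpace ↥(unitaryGroupOfForm (galAdicCompletionMap (L := L) (IsCMField.complexConj L) hw) J)]
    [BorelSpace ↥(unitaryGroupOfForm (galAdicCompletionMap (L := L) (IsCMField.complexConj L) hw) J)]
    (ν : Measure ↥(unitaryGroupOfForm (galAdicCompletionMap (L := L) (IsCMField.complexConj L) hw) J)) [ν.IsHaarMeasure] (k : ℕ)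
    (hHCD : ∀ g₀ : ↥(unitaryGroupOfForm (galAdicCompletionMap (L := L) (IsCMField.complexConj L) hw) J), ∃ U ∈ 𝓝 g₀, ∫⁻ g in U,
      (((normAbs (w.1.adicCompletion L) (((g : GL (Fin 2) (w.1.adicCompletion L)) : Matrix (Fin 2) (Fin 2) (w.1.adicCompletion L))).charpoly.discr *
        (normAbs (w.1.adicCompletion L) (((g : GL (Fin 2) (w.1.adicCompletion L)) : Matrix (Fin 2) (Fin 2) (w.1.adicCompletion L))).det ^ 2)⁻¹ : ℝ≥0) : ℝ≥0∞)) ^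
        (-((1 + 1 / 4) / 4 : ℝ)) ∂ν < ∞) :
    LocallyIntegrable (fun m : ↥(unitaryGroupOfForm (galAdicCompletionMap (L := L) (IsCMField.complexConj L) hw) J) =>
      (((NNReal.sqrt (NNReal.sqrt
        (normAbs (w.1.adicCompletion L) (((m : GL (Fin 2) (w.1.adicCompletion L)) : Matrix (Fin 2) (Fin 2) (w.1.adicCompletion L))).charpoly.discr *
          (normAbs (w.1.adicCompletion L) (((m : GL (Fin 2) (w.1.adicCompletion L)) : Matrix (Fin 2) (Fin 2) (w.1.adicCompletion L))).det ^ 2)⁻¹)) : ℝ≥0) : ℝ))⁻¹ *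
        (1 + |Real.log (((NNReal.sqrt (NNReal.sqrt
          (normAbs (w.1.adicCompletion L) (((m : GL (Fin 2) (w.1.adicCompletion L)) : Matrix (Fin 2) (Fin 2) (w.1.adicCompletion L))).charpoly.discr *
            (normAbs (w.1.adicCompletion L) (((m : GL (Fin 2) (w.1.adicCompletion L)) : Matrix (Fin 2) (Fin 2) (w.1.adicCompletion L))).det ^ 2)⁻¹)) : ℝ≥0) : ℝ))|) ^ k) ν :=
  locallyIntegrable_inv_token_mul_log_pow_of_hcd (continuous_galAdicCompletionMap L (IsCMField.complexConj L) hw) J ν k hHCD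

end Place

end Summit.HodgeConjecture.HodgeConjecture.Cruxes.H413.K2E3SupercuspidalTruncatedCharWeightKitTwo

end
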